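import Mathlib

/-!
# Stub `stub_amgm3` of line `Sketch` — crux `stmt-MatrixMultiplication-7359` (`SingleAutomatonRigidity`)

Route `MatrixMultiplication/AutomaticSTPPDesigns`, crux `stmt-MatrixMultiplication-7359`
(`Summit.MatrixMultiplication.MatrixMultiplication.Theses.AutomaticSTPPDesigns.SingleAutomatonRigidity`),
line `Sketch`, stub `stub_amgm3`.

Weighted AM–GM with a free scale parameter `L > 0`:
`(xyz)^{1/3} = ((L²x) · (y/L) · (z/L))^{1/3} ≤ (L²x + y/L + z/L)/3`,
from Mathlib's `Real.geom_mean_le_arith_mean3_weighted` with all three weights `1/3`,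
`Real.mul_rpow`, and the identity `L²x · (y/L) · (z/L) = xyz` (valid since `L ≠ 0`).
-/

set_option linter.dupNamespace false

namespace Summit.MatrixMultiplication.MatrixMultiplication.Theorems.SingleAutomatonRigidity

/-- **Weighted AM–GM** with a free parameter `L > 0`:
`(xyz)^{1/3} = (L²x · y/L · z/L)^{1/3} ≤ (L²x + y/L + z/L)/3`
(`Real.geom_mean_le_arith_mean3_weighted` with weights `1/3`). -/
theorem stub_amgm3 (x y z L : ℝ) (hx : 0 ≤ x) (hy : 0 ≤ y) (hz : 0 ≤ z) (hL : 0 < L) :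
    (x * y * z) ^ ((1 : ℝ) / 3) ≤ (L ^ 2 * x + y / L + z / L) / 3 := by
  have h1 : 0 ≤ L ^ 2 * x := by positivity
  have h2 : 0 ≤ y / L := by positivity
  have h3 : 0 ≤ z / L := by positivity
  have h := Real.geom_mean_le_arith_mean3_weighted (w₁ := 1 / 3) (w₂ := 1 / 3) (w₃ := 1 / 3)
    (p₁ := L ^ 2 * x) (p₂ := y / L) (p₃ := z / L) (by norm_num) (by norm_num) (by norm_num)
    h1 h2 h3 (by norm_num)
  have e : (L ^ 2 * x) ^ ((1 : ℝ) / 3) * (y / L) ^ ((1 : ℝ) / 3) * (z / L) ^ ((1 : ℝ) / 3) =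
      (x * y * z) ^ ((1 : ℝ) / 3) := by
    rw [← Real.mul_rpow h1 h2, ← Real.mul_rpow (mul_nonneg h1 h2) h3]
    congr 1
    field_simp
  rw [e] at h
  linarith
end Summit.MatrixMultiplication.MatrixMultiplication.Theorems.SingleAutomatonRigidity
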